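import Summits.QuantumFields.YangMills.Theorems.BalabanUVNodesN11OmegaTopTStep
import Summits.QuantumFields.YangMills.Theorems.BalabanUVNodesN11TopChildO3AtRecord13

/-!
# DAG node N11 — THE (O3′) CLAUSE AT EVERY CHILD WITH `Ω_{k+1} = 𝕋`, STAGE-13 LETTERS; AT `k = 0` (the pairs `(Ω₁, Λ₁) = (𝕋, Λ₁)`, no new large plaquette field) IT IS
# [III] (3.23)–(3.25)'s first step verbatim-shaped — ONE explicit identity per pair; and THEOREM 1 AT LEVEL 1 on the live-selector line SPLIT by the kind of child:
# explicit identities at the `Ω₁ = 𝕋` pairs, dag-n08-w2's first-step clauses at the `Ω₁ ⊊ 𝕋` pairs (the frozen-`y` road), dag-n11-d's level-0 no-expansion clause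

HEADER — WORK-UNIT METADATA.  Cell `pub-ymgap`, YM-PLAN Track A (HUMAN RULING D-0062), seat `pub-ymgap-dag-n11-d` (g18; N11 [B14], s2), route `BalabanUVNodes`, item K1⁹ =
stmt-QuantumFields-27364 (helper lane, `--kind proof --supports 27364 --as helper`, count-neutral).  [III] = [Balaban1988Convergent], [I] = [Balaban1987RG1], [II] = [Balaban1988RG2Cluster].
Over this seat's g18 `…N11OmegaTopTStep` (★★★ `O3_iff_of_Omega_univ`), `…N11TopChildO3AtRecord13` (the top pair), dag-n11-e's `…N11Sect3SupplyChainDefs` (`PresentChildObligations`),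
dag-n08-w2's `…N11SupplyChainFirstLink` (`FirstStepClausesAt`, `presentChildObligations_zero_iff`, ★ `sLaw₁₃CoPH_one_of_firstStepClauses`), dag-n11-e's `sideD_pos`.

WHY THIS FILE.  `…N11OmegaTopTStep` shows that at a child with `Ω_{k+1}(s′) = 𝕋` both members of (O3′) are explicit functions of the new field — def-T's one-step transport of
`χ′_k(ALL)·(Σ_{R,S}ζ)·χ_k slot_k` and `Σ_Y ζ_k(∅)·∫dA_k|_{Λ^c}[…] exp A_{k+1}` — with no conditional expectation per fibre to read.  This file writes that clause at the Stage-13 letters of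
the cured v1.7 record for every level, specialises to the first step (`ρ₀`, `χ₀ ≡ 1`, no lower generation), and assembles THEOREM 1 AT LEVEL 1 (`SLaw₁₃CoPH θ p 1`) on the live-selector line
from: the explicit identities at the pairs `(𝕋, Λ₁)` + r11's new-term clauses there, dag-n08-w2's `FirstStepClausesAt` at the pairs with `Ω₁ ⊊ 𝕋` (where old variables ARE retained and
the frozen-`y` road of g17 applies), the level-1 𝐄-clauses, and the level-0 no-expansion clause.

WHAT THIS FILE PROVES (0 `def`, 0 `sorry`, standard axioms).  §1 every level (`1 ≤ M`): ★★★ `O3_iff_of_Omega_univ_at_record₁₃` · ★★★ `presentChild_O3_of_Omega_univ_of_identity`.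
§2 the first step: ★★★ `firstStep_O3_iff_of_Omega_univ` ((iii) of `FirstStepClausesAt θ p s′ u₁ e₁` at a pair `(𝕋, Λ₁)` ↔ «`𝐓ρ₀(s′) ≡ 0 ∨` for a.e. `V′` with every χ₁-cube (3.2)-small:
`∫dU δ(ŪV′⁻¹)[χ′_0(ALL)(U,V′)·Σ_{R,S}[Λ₁(R)=Λ₁]ζ_1(∅,∅,(R,S))(U,V′)·ρ₀(U)](V′) = Σ_{Y⊆Λ₁ᶜ} ζ_0(∅)(base₁V′)·∫dA_0|_{B_0(Λ₁ᶜ)} χ_A(Λ₁ᶜ,Y)e^{−½quad_0(Λ₁)}·exp A_1(s′; u₁,(S_Y,A_0),e₁)`») ·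
★★★ `firstStepClausesAt_of_Omega_univ_of_identity` ∕ `presentChildObligations_zero_of_Omega_univ_of_identity` · ★★★ `sLaw₁₃CoPH_one_of_split` (Theorem 1 at level 1 from the split data).

HONEST FRAMING.  Helper lane of K1⁹; count-neutral; compositions BY NAME; the identities are DISPLAYED (hypotheses ∕ one side of an `↔`) — they ARE [I] §§2–3 + [II] + [III] Thm 2 at
the first step, NOT proved; nothing of Bałaban asserted; the new terms and their bounds are the supplier's; N11 NOT discharged; K1⁹ NOT closed, no registered stub touched; counts unmoved
(typed 28∕28 · discharged 5∕27 · A 5∕28).  One finite `𝕋⁴_{L^K}` programme at fixed `ε = L^{−K}` — NOT ℝ⁴, NOT OS, NOT a mass gap, NOT Clay.  No `sorry`, `axiom`, `def`, `instance`,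
`notation`.  Sources (SHAPE only): [III] Thm 1 p.262, Thm 2 p.263, Theorem p.245, (2.18) p.257, (2.21)–(2.23) p.258, (3.1) p.264, (3.2)–(3.5) p.265, (3.16) p.268, (3.20)–(3.21) p.269,
(3.23)–(3.25) p.270, §3 p.279; [I] Thm 1 p.259, §2 p.267, §3 p.272; [IV] = [Balaban1989LargeFieldI] (0.2)–(0.4) p.176.
-/

noncomputable section

open MeasureTheory
open scoped BigOperators Matrix.Norms.L2Operator

namespace Summit.QuantumFields.YangMills.Theorems.BalabanUVNodesN11OmegaTopO3AtRecord13

open Literature.MathematicalPhysics.QuantumFieldTheory.Balaban1983to89 T4Continuum Node00 Node00.Tk B14.Eq218Concrete B14.Sect3Decomp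
open BalabanUVNodesN11Sect3SupplySpliceOwnBoundary (graftAboveB)
open BalabanUVNodesN11Sect3SupplyChainDefs (PresentChildObligations NewEClausesAt NoExpansionClauseFor baseWitness)
open BalabanUVNodesN11SupplyChainFirstLink (FirstStepClausesAt presentChildObligations_zero_iff sLaw₁₃CoPH_one_of_firstStepClauses)
open BalabanUVNodesN11FirstStepSupply (slotsOfRecord₁₃H_zero_eq_rhoZero)
open BalabanUVNodesN11AllLargeFieldLabel (sideD_pos)
open BalabanUVNodesN11OmegaTopTStep (O3_iff_of_Omega_univ slotsTOfRecord_succ_eq_of_Omega_univ_of_chiSeq_ne_zero sect2Slot_eq_of_Omega_univ)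

variable {F : T4Family} {N : ℕ} [NeZero N]

/-! ## §1. Every level: the (O3′) clause at a child with `Ω_{k+1} = 𝕋` of the Stage-13 record -/

section EveryLevel

variable (θ : Stage13HParams F N) (p : B12.RunParams)

/-- ★★★ **THE (O3′)-SHAPED CLAUSE AT A CHILD WITH `Ω_{k+1} = 𝕋` OF THE STAGE-13 RECORD IS ONE EXPLICIT IDENTITY** (`1 ≤ M`; any term values `t′`, constant `E′`; `{hdec}` = any
`DecidableEq` on the level-`k` bonds, unified with 11a's). [cite: Balaban1988Convergent, Thm 1 p.262, Thm 2 p.263, (3.1) p.264, (3.23)–(3.25) p.270, (2.18) p.257, (2.21)–(2.23) p.258; Balaban1987RG1, Thm 1 p.259] -/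
theorem O3_iff_of_Omega_univ_at_record₁₃ (hM : 1 ≤ θ.τ9.M) {k : ℕ} (s' : SeqOfRecord F θ.ν θ.τ9.M (gOfRecord₁₃ F N θ.toStage13Params p) p.K (k + 1))
    (hΩ : s'.Ω (k + 1) = Set.univ) (t' : Sect2.TermValues (F.P p.K) (MatA N) (FluctV N) θ.τ9.M) (E' : ℝ) {hdec : DecidableEq (PBond (F.P p.K) k)} :
    (slotsTOfRecord F N θ.ν θ.τ9 (EOfRecord₁₃ F N θ.toStage13Params) (wOfRecord₉ F N θ.toStage9Params) θ.ppSel p (gOfRecord₁₃ F N θ.toStage13Params p) (k + 1) s' = 0 ∨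
      ∀ᵐ V' ∂fieldMeasure (F.P p.K) (k + 1) (SU N),
        chiSeqOfRecord F N θ.ν θ.τ9.M (gOfRecord₁₃ F N θ.toStage13Params p) p.K (k + 1) s' V' ≠ 0 →
          slotsTOfRecord F N θ.ν θ.τ9 (EOfRecord₁₃ F N θ.toStage13Params) (wOfRecord₉ F N θ.toStage9Params) θ.ppSel p (gOfRecord₁₃ F N θ.toStage13Params p) (k + 1) s' V' =
            sect2Slot F N (FluctV N) p.K (settingOfRecord₁₃ F N θ.toStage13Params p) (θ.rzAt p s') (WtOfRecord₁₃H F N θ p s') s' t' E'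
              (UbgOfRecord₁₃CoP F N θ.toStage13Params p (k + 1) s') V') ↔
    (slotsTOfRecord F N θ.ν θ.τ9 (EOfRecord₁₃ F N θ.toStage13Params) (wOfRecord₉ F N θ.toStage9Params) θ.ppSel p (gOfRecord₁₃ F N θ.toStage13Params p) (k + 1) s' = 0 ∨
      ∀ᵐ V' ∂fieldMeasure (F.P p.K) (k + 1) (SU N),
        chiSeqOfRecord F N θ.ν θ.τ9.M (gOfRecord₁₃ F N θ.toStage13Params p) p.K (k + 1) s' V' ≠ 0 →
          transportOfRecord F N p.K k (fun U =>
              chiPrime (sect3DataOfRecord F N θ.ν θ.τ9.M p (gOfRecord₁₃ F N θ.toStage13Params p) k s'.init) (avOfRecord F N p.K)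
                  (2 * deltaOfRecord θ.ν (gOfRecord₁₃ F N θ.toStage13Params p) k θ.A₁) (Finset.univ : Finset (Iχ F θ.ν p (gOfRecord₁₃ F N θ.toStage13Params p) k)) U V' *
                (∑ R : Finset (Iχ F θ.ν p (gOfRecord₁₃ F N θ.toStage13Params p) k), ∑ S : Finset (Iχ F θ.ν p (gOfRecord₁₃ F N θ.toStage13Params p) k),
                  if LambdaOfLabel F θ.ν θ.τ9.M p (gOfRecord₁₃ F N θ.toStage13Params p) k s'.init (∅, ∅, (R, ∅)) = s'.Λ (k + 1) then
                    θ.ζ p (gOfRecord₁₃ F N θ.toStage13Params p) k s'.init ∅ ∅ (R, S) U V' else 0) *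
                (chiSeqOfRecord F N θ.ν θ.τ9.M (gOfRecord₁₃ F N θ.toStage13Params p) p.K k s'.init U *
                  slotsOfRecord F N θ.ν θ.τ9 (EOfRecord₁₃ F N θ.toStage13Params) (wOfRecord₉ F N θ.toStage9Params) θ.ppSel p (gOfRecord₁₃ F N θ.toStage13Params p) k s'.init U)) V' =
            ∑ Y ∈ (Set.toFinite {Y : Set (Site (F.P p.K) 0) | Y ∈ SClassOfRecord F θ.ν (gOfRecord₁₃ F N θ.toStage13Params p) p.K (k + 1) ∧ Y ⊆ s'.Ω (k + 1) ∩ (s'.Λ (k + 1))ᶜ}).toFinset,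
              (WtOfRecord₁₃H F N θ p s').ζ k (s'.Ω (k + 1))ᶜ (baseCfg (k + 1) V') *
                aOp k (genDataOfRecord F N (FluctV N) θ.ν θ.τ9.M (gOfRecord₁₃ F N θ.toStage13Params p) p.K (WtOfRecord₁₃H F N θ p s') s' (Function.update (fun _ => ∅) (k + 1) Y) k).sA
                  (genDataOfRecord F N (FluctV N) θ.ν θ.τ9.M (gOfRecord₁₃ F N θ.toStage13Params p) p.K (WtOfRecord₁₃H F N θ p s') s' (Function.update (fun _ => ∅) (k + 1) Y) k).w
                  (fun ω => (∏ j ∈ Finset.range k, (WtOfRecord₁₃H F N θ p s').ζ j ∅ ω * (WtOfRecord₁₃H F N θ p s').w j Set.univ ∅ ∅ ω) *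
                    sect2Operand F N (FluctV N) p.K (settingOfRecord₁₃ F N θ.toStage13Params p) (θ.rzAt p s') s' t' E'
                      (UbgOfRecord₁₃CoP F N θ.toStage13Params p (k + 1) s') (Function.update (fun _ => ∅) (k + 1) Y, fun j => (ω j).2) (fun j => (ω j).1))
                  (baseCfg (k + 1) V')) :=
  O3_iff_of_Omega_univ F N θ.ν θ.τ9 (EOfRecord₁₃ F N θ.toStage13Params) θ.A₁ θ.ζ θ.ppSel p (gOfRecord₁₃ F N θ.toStage13Params p) k
    (settingOfRecord₁₃ F N θ.toStage13Params p) (θ.rzAt p s') (WtOfRecord₁₃H F N θ p s') (sideD_pos θ.ν hM p _ k) s' hΩ t' E' _ (hdec := hdec)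

/-- ★★★ **THE (O3′) CONJUNCT OF `PresentChildObligations` AT A CHILD WITH `Ω_{k+1} = 𝕋` FROM THE EXPLICIT IDENTITY** for `(graftAboveB k (t (init s′)) (tnew s′), EkN s′)`.
[cite: Balaban1988Convergent, Thm 2 p.263, §3 p.279, (3.23)–(3.25) p.270, (2.18) p.257; Balaban1987RG1, Thm 1 p.259] -/
theorem presentChild_O3_of_Omega_univ_of_identity (hM : 1 ≤ θ.τ9.M) {k : ℕ} {hdec : DecidableEq (PBond (F.P p.K) k)}
    (t : SeqOfRecord F θ.ν θ.τ9.M (gOfRecord₁₃ F N θ.toStage13Params p) p.K k → Sect2.TermValues (F.P p.K) (MatA N) (FluctV N) θ.τ9.M)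
    (tnew : SeqOfRecord F θ.ν θ.τ9.M (gOfRecord₁₃ F N θ.toStage13Params p) p.K (k + 1) → Sect2.TermValues (F.P p.K) (MatA N) (FluctV N) θ.τ9.M)
    (EkN : SeqOfRecord F θ.ν θ.τ9.M (gOfRecord₁₃ F N θ.toStage13Params p) p.K (k + 1) → ℝ)
    (s' : SeqOfRecord F θ.ν θ.τ9.M (gOfRecord₁₃ F N θ.toStage13Params p) p.K (k + 1)) (hΩ : s'.Ω (k + 1) = Set.univ)
    (hT : slotsTOfRecord F N θ.ν θ.τ9 (EOfRecord₁₃ F N θ.toStage13Params) (wOfRecord₉ F N θ.toStage9Params) θ.ppSel p (gOfRecord₁₃ F N θ.toStage13Params p) (k + 1) s' = 0 ∨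
      ∀ᵐ V' ∂fieldMeasure (F.P p.K) (k + 1) (SU N),
        chiSeqOfRecord F N θ.ν θ.τ9.M (gOfRecord₁₃ F N θ.toStage13Params p) p.K (k + 1) s' V' ≠ 0 →
          transportOfRecord F N p.K k (fun U =>
              chiPrime (sect3DataOfRecord F N θ.ν θ.τ9.M p (gOfRecord₁₃ F N θ.toStage13Params p) k s'.init) (avOfRecord F N p.K)
                  (2 * deltaOfRecord θ.ν (gOfRecord₁₃ F N θ.toStage13Params p) k θ.A₁) (Finset.univ : Finset (Iχ F θ.ν p (gOfRecord₁₃ F N θ.toStage13Params p) k)) U V' *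
                (∑ R : Finset (Iχ F θ.ν p (gOfRecord₁₃ F N θ.toStage13Params p) k), ∑ S : Finset (Iχ F θ.ν p (gOfRecord₁₃ F N θ.toStage13Params p) k),
                  if LambdaOfLabel F θ.ν θ.τ9.M p (gOfRecord₁₃ F N θ.toStage13Params p) k s'.init (∅, ∅, (R, ∅)) = s'.Λ (k + 1) then
                    θ.ζ p (gOfRecord₁₃ F N θ.toStage13Params p) k s'.init ∅ ∅ (R, S) U V' else 0) *
                (chiSeqOfRecord F N θ.ν θ.τ9.M (gOfRecord₁₃ F N θ.toStage13Params p) p.K k s'.init U *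
                  slotsOfRecord F N θ.ν θ.τ9 (EOfRecord₁₃ F N θ.toStage13Params) (wOfRecord₉ F N θ.toStage9Params) θ.ppSel p (gOfRecord₁₃ F N θ.toStage13Params p) k s'.init U)) V' =
            ∑ Y ∈ (Set.toFinite {Y : Set (Site (F.P p.K) 0) | Y ∈ SClassOfRecord F θ.ν (gOfRecord₁₃ F N θ.toStage13Params p) p.K (k + 1) ∧ Y ⊆ s'.Ω (k + 1) ∩ (s'.Λ (k + 1))ᶜ}).toFinset,
              (WtOfRecord₁₃H F N θ p s').ζ k (s'.Ω (k + 1))ᶜ (baseCfg (k + 1) V') *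
                aOp k (genDataOfRecord F N (FluctV N) θ.ν θ.τ9.M (gOfRecord₁₃ F N θ.toStage13Params p) p.K (WtOfRecord₁₃H F N θ p s') s' (Function.update (fun _ => ∅) (k + 1) Y) k).sA
                  (genDataOfRecord F N (FluctV N) θ.ν θ.τ9.M (gOfRecord₁₃ F N θ.toStage13Params p) p.K (WtOfRecord₁₃H F N θ p s') s' (Function.update (fun _ => ∅) (k + 1) Y) k).w
                  (fun ω => (∏ j ∈ Finset.range k, (WtOfRecord₁₃H F N θ p s').ζ j ∅ ω * (WtOfRecord₁₃H F N θ p s').w j Set.univ ∅ ∅ ω) *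
                    sect2Operand F N (FluctV N) p.K (settingOfRecord₁₃ F N θ.toStage13Params p) (θ.rzAt p s') s' (graftAboveB k (t s'.init) (tnew s')) (EkN s')
                      (UbgOfRecord₁₃CoP F N θ.toStage13Params p (k + 1) s') (Function.update (fun _ => ∅) (k + 1) Y, fun j => (ω j).2) (fun j => (ω j).1))
                  (baseCfg (k + 1) V')) :
    slotsTOfRecord F N θ.ν θ.τ9 (EOfRecord₁₃ F N θ.toStage13Params) (wOfRecord₉ F N θ.toStage9Params) θ.ppSel p (gOfRecord₁₃ F N θ.toStage13Params p) (k + 1) s' = 0 ∨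
      ∀ᵐ V' ∂fieldMeasure (F.P p.K) (k + 1) (SU N),
        chiSeqOfRecord F N θ.ν θ.τ9.M (gOfRecord₁₃ F N θ.toStage13Params p) p.K (k + 1) s' V' ≠ 0 →
          slotsTOfRecord F N θ.ν θ.τ9 (EOfRecord₁₃ F N θ.toStage13Params) (wOfRecord₉ F N θ.toStage9Params) θ.ppSel p (gOfRecord₁₃ F N θ.toStage13Params p) (k + 1) s' V' =
            sect2Slot F N (FluctV N) p.K (settingOfRecord₁₃ F N θ.toStage13Params p) (θ.rzAt p s') (WtOfRecord₁₃H F N θ p s') s'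
              (graftAboveB k (t s'.init) (tnew s')) (EkN s') (UbgOfRecord₁₃CoP F N θ.toStage13Params p (k + 1) s') V' :=
  (O3_iff_of_Omega_univ_at_record₁₃ θ p hM s' hΩ _ _ (hdec := hdec)).2 hT

end EveryLevel

/-! ## §2. The first step at a pair `(Ω₁, Λ₁) = (𝕋, Λ₁)`: [III] (3.23)–(3.25) verbatim-shaped; Theorem 1 at level 1 split by the kind of child -/

section FirstStep

variable (θ : Stage13HParams F N) (p : B12.RunParams)

/-- ★★★ **[I] + [II] + [III] Thm 2 AT A FIRST-STEP PAIR `(𝕋, Λ₁)`, AS THE TREE NEEDS IT** (`1 ≤ M`): clause (iii) of `FirstStepClausesAt θ p s′ u₁ e₁` at a history `s′ = (𝕋, Λ₁)` IS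
«`𝐓ρ₀(s′) ≡ 0 ∨` for `dV′`-a.e. `V′` with every χ₁-cube (3.2)-small:
`∫dU δ(ŪV′⁻¹) [χ′_0(ALL cubes)(U,V′) · Σ_{R,S}[Λ₁(R)=Λ₁] ζ_1(∅,∅,(R,S))(U,V′) · ρ₀(U)] (V′) = Σ_{Y⊆Λ₁ᶜ adm.} ζ_0(∅)(base₁V′) · ∫dA_0|_{B_0(Λ₁ᶜ)} [χ_A(Λ₁ᶜ,Y)e^{−½quad_0(Λ₁)}](ω^A) · exp A_1(s′; u₁, (S_Y, A_0), e₁)(U_1(ω^A))`»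
— the old field integrated ONCE along Bałaban's averaging on the left; on the right the NEW large-fluctuation variables on `Λ₁ᶜ` integrated against (3.23)'s weight and the new action EVALUATED;
no δ-function, no frozen variable, no chart in the statement. [cite: Balaban1987RG1, Thm 1 p.259, §2 p.267, §3 p.272; Balaban1988Convergent, Thm 2 p.263, (3.1) p.264, (3.2)–(3.5) p.265, (3.16) p.268, (3.20)–(3.21) p.269, (3.23)–(3.25) p.270, (2.21)–(2.23) p.258] -/
theorem firstStep_O3_iff_of_Omega_univ (hM : 1 ≤ θ.τ9.M) (s' : SeqOfRecord F θ.ν θ.τ9.M (gOfRecord₁₃ F N θ.toStage13Params p) p.K 1)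
    (hΩ : s'.Ω 1 = Set.univ) (u₁ : Sect2.TermValues (F.P p.K) (MatA N) (FluctV N) θ.τ9.M) (e₁ : ℝ) {hdec : DecidableEq (PBond (F.P p.K) 0)} :
    (slotsTOfRecord F N θ.ν θ.τ9 (EOfRecord₁₃ F N θ.toStage13Params) (wOfRecord₉ F N θ.toStage9Params) θ.ppSel p (gOfRecord₁₃ F N θ.toStage13Params p) 1 s' = 0 ∨
      ∀ᵐ V' ∂fieldMeasure (F.P p.K) 1 (SU N),
        chiSeqOfRecord F N θ.ν θ.τ9.M (gOfRecord₁₃ F N θ.toStage13Params p) p.K 1 s' V' ≠ 0 →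
          slotsTOfRecord F N θ.ν θ.τ9 (EOfRecord₁₃ F N θ.toStage13Params) (wOfRecord₉ F N θ.toStage9Params) θ.ppSel p (gOfRecord₁₃ F N θ.toStage13Params p) 1 s' V' =
            sect2Slot F N (FluctV N) p.K (settingOfRecord₁₃ F N θ.toStage13Params p) (θ.rzAt p s') (WtOfRecord₁₃H F N θ p s') s' u₁ e₁
              (UbgOfRecord₁₃CoP F N θ.toStage13Params p 1 s') V') ↔
    (slotsTOfRecord F N θ.ν θ.τ9 (EOfRecord₁₃ F N θ.toStage13Params) (wOfRecord₉ F N θ.toStage9Params) θ.ppSel p (gOfRecord₁₃ F N θ.toStage13Params p) 1 s' = 0 ∨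
      ∀ᵐ V' ∂fieldMeasure (F.P p.K) 1 (SU N),
        chiSeqOfRecord F N θ.ν θ.τ9.M (gOfRecord₁₃ F N θ.toStage13Params p) p.K 1 s' V' ≠ 0 →
          transportOfRecord F N p.K 0 (fun U =>
              chiPrime (sect3DataOfRecord F N θ.ν θ.τ9.M p (gOfRecord₁₃ F N θ.toStage13Params p) 0 s'.init) (avOfRecord F N p.K)
                  (2 * deltaOfRecord θ.ν (gOfRecord₁₃ F N θ.toStage13Params p) 0 θ.A₁) (Finset.univ : Finset (Iχ F θ.ν p (gOfRecord₁₃ F N θ.toStage13Params p) 0)) U V' *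
                (∑ R : Finset (Iχ F θ.ν p (gOfRecord₁₃ F N θ.toStage13Params p) 0), ∑ S : Finset (Iχ F θ.ν p (gOfRecord₁₃ F N θ.toStage13Params p) 0),
                  if LambdaOfLabel F θ.ν θ.τ9.M p (gOfRecord₁₃ F N θ.toStage13Params p) 0 s'.init (∅, ∅, (R, ∅)) = s'.Λ 1 then
                    θ.ζ p (gOfRecord₁₃ F N θ.toStage13Params p) 0 s'.init ∅ ∅ (R, S) U V' else 0) *
                rhoZeroOfRecord F N p.K (gOfRecord₁₃ F N θ.toStage13Params p 0) (EOfRecord₁₃ F N θ.toStage13Params p) U) V' =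
            ∑ Y ∈ (Set.toFinite {Y : Set (Site (F.P p.K) 0) | Y ∈ SClassOfRecord F θ.ν (gOfRecord₁₃ F N θ.toStage13Params p) p.K 1 ∧ Y ⊆ s'.Ω 1 ∩ (s'.Λ 1)ᶜ}).toFinset,
              (WtOfRecord₁₃H F N θ p s').ζ 0 ∅ (baseCfg 1 V') *
                aOp 0 (genDataOfRecord F N (FluctV N) θ.ν θ.τ9.M (gOfRecord₁₃ F N θ.toStage13Params p) p.K (WtOfRecord₁₃H F N θ p s') s' (Function.update (fun _ => ∅) 1 Y) 0).sA
                  (genDataOfRecord F N (FluctV N) θ.ν θ.τ9.M (gOfRecord₁₃ F N θ.toStage13Params p) p.K (WtOfRecord₁₃H F N θ p s') s' (Function.update (fun _ => ∅) 1 Y) 0).w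
                  (fun ω => sect2Operand F N (FluctV N) p.K (settingOfRecord₁₃ F N θ.toStage13Params p) (θ.rzAt p s') s' u₁ e₁
                      (UbgOfRecord₁₃CoP F N θ.toStage13Params p 1 s') (Function.update (fun _ => ∅) 1 Y, fun j => (ω j).2) (fun j => (ω j).1))
                  (baseCfg 1 V')) := by
  have hD := sideD_pos (F := F) θ.ν hM p (gOfRecord₁₃ F N θ.toStage13Params p) 0
  have hΩc : (s'.Ω (0 + 1))ᶜ = ∅ := by rw [show s'.Ω (0 + 1) = Set.univ from hΩ, Set.compl_univ]
  refine or_congr_right (Filter.eventually_congr (Filter.Eventually.of_forall fun V' => ?_))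
  refine imp_congr_right fun hχ => ?_
  have hfun : (fun U => chiPrime (sect3DataOfRecord F N θ.ν θ.τ9.M p (gOfRecord₁₃ F N θ.toStage13Params p) 0 s'.init) (avOfRecord F N p.K)
          (2 * deltaOfRecord θ.ν (gOfRecord₁₃ F N θ.toStage13Params p) 0 θ.A₁) (Finset.univ : Finset (Iχ F θ.ν p (gOfRecord₁₃ F N θ.toStage13Params p) 0)) U V' *
        (∑ R : Finset (Iχ F θ.ν p (gOfRecord₁₃ F N θ.toStage13Params p) 0), ∑ S : Finset (Iχ F θ.ν p (gOfRecord₁₃ F N θ.toStage13Params p) 0),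
          if LambdaOfLabel F θ.ν θ.τ9.M p (gOfRecord₁₃ F N θ.toStage13Params p) 0 s'.init (∅, ∅, (R, ∅)) = s'.Λ (0 + 1) then
            θ.ζ p (gOfRecord₁₃ F N θ.toStage13Params p) 0 s'.init ∅ ∅ (R, S) U V' else 0) *
        (chiSeqOfRecord F N θ.ν θ.τ9.M (gOfRecord₁₃ F N θ.toStage13Params p) p.K 0 s'.init U *
          slotsOfRecord F N θ.ν θ.τ9 (EOfRecord₁₃ F N θ.toStage13Params) (wOfRecord₉ F N θ.toStage9Params) θ.ppSel p (gOfRecord₁₃ F N θ.toStage13Params p) 0 s'.init U)) =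
      fun U => chiPrime (sect3DataOfRecord F N θ.ν θ.τ9.M p (gOfRecord₁₃ F N θ.toStage13Params p) 0 s'.init) (avOfRecord F N p.K)
          (2 * deltaOfRecord θ.ν (gOfRecord₁₃ F N θ.toStage13Params p) 0 θ.A₁) (Finset.univ : Finset (Iχ F θ.ν p (gOfRecord₁₃ F N θ.toStage13Params p) 0)) U V' *
        (∑ R : Finset (Iχ F θ.ν p (gOfRecord₁₃ F N θ.toStage13Params p) 0), ∑ S : Finset (Iχ F θ.ν p (gOfRecord₁₃ F N θ.toStage13Params p) 0),
          if LambdaOfLabel F θ.ν θ.τ9.M p (gOfRecord₁₃ F N θ.toStage13Params p) 0 s'.init (∅, ∅, (R, ∅)) = s'.Λ 1 then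
            θ.ζ p (gOfRecord₁₃ F N θ.toStage13Params p) 0 s'.init ∅ ∅ (R, S) U V' else 0) *
        rhoZeroOfRecord F N p.K (gOfRecord₁₃ F N θ.toStage13Params p 0) (EOfRecord₁₃ F N θ.toStage13Params p) U := by
    funext U
    rw [chiSeqOfRecord_zero, one_mul, slotsOfRecord₁₃H_zero_eq_rhoZero]
  have hrhs : ∀ Y : Set (Site (F.P p.K) 0),
      (WtOfRecord₁₃H F N θ p s').ζ 0 (s'.Ω (0 + 1))ᶜ (baseCfg (0 + 1) V') *
        aOp 0 (genDataOfRecord F N (FluctV N) θ.ν θ.τ9.M (gOfRecord₁₃ F N θ.toStage13Params p) p.K (WtOfRecord₁₃H F N θ p s') s' (Function.update (fun _ => ∅) (0 + 1) Y) 0).sA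
          (genDataOfRecord F N (FluctV N) θ.ν θ.τ9.M (gOfRecord₁₃ F N θ.toStage13Params p) p.K (WtOfRecord₁₃H F N θ p s') s' (Function.update (fun _ => ∅) (0 + 1) Y) 0).w
          (fun ω => (∏ j ∈ Finset.range 0, (WtOfRecord₁₃H F N θ p s').ζ j ∅ ω * (WtOfRecord₁₃H F N θ p s').w j Set.univ ∅ ∅ ω) *
            sect2Operand F N (FluctV N) p.K (settingOfRecord₁₃ F N θ.toStage13Params p) (θ.rzAt p s') s' u₁ e₁
              (UbgOfRecord₁₃CoP F N θ.toStage13Params p (0 + 1) s') (Function.update (fun _ => ∅) (0 + 1) Y, fun j => (ω j).2) (fun j => (ω j).1))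
          (baseCfg (0 + 1) V') =
      (WtOfRecord₁₃H F N θ p s').ζ 0 ∅ (baseCfg 1 V') *
        aOp 0 (genDataOfRecord F N (FluctV N) θ.ν θ.τ9.M (gOfRecord₁₃ F N θ.toStage13Params p) p.K (WtOfRecord₁₃H F N θ p s') s' (Function.update (fun _ => ∅) 1 Y) 0).sA
          (genDataOfRecord F N (FluctV N) θ.ν θ.τ9.M (gOfRecord₁₃ F N θ.toStage13Params p) p.K (WtOfRecord₁₃H F N θ p s') s' (Function.update (fun _ => ∅) 1 Y) 0).w
          (fun ω => sect2Operand F N (FluctV N) p.K (settingOfRecord₁₃ F N θ.toStage13Params p) (θ.rzAt p s') s' u₁ e₁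
              (UbgOfRecord₁₃CoP F N θ.toStage13Params p 1 s') (Function.update (fun _ => ∅) 1 Y, fun j => (ω j).2) (fun j => (ω j).1))
          (baseCfg 1 V') := fun Y => by
    rw [hΩc]
    simp only [Finset.prod_range_zero, one_mul]
  rw [slotsTOfRecord_succ_eq_of_Omega_univ_of_chiSeq_ne_zero F N θ.ν θ.τ9 (EOfRecord₁₃ F N θ.toStage13Params) θ.A₁ θ.ζ θ.ppSel p (gOfRecord₁₃ F N θ.toStage13Params p) 0 hD s' hΩ V' hχ,
    sect2Slot_eq_of_Omega_univ F N θ.ν θ.τ9 p (gOfRecord₁₃ F N θ.toStage13Params p) 0 (settingOfRecord₁₃ F N θ.toStage13Params p) (θ.rzAt p s') (WtOfRecord₁₃H F N θ p s') s' hΩ u₁ e₁ _ V'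
      (hdec := hdec), hfun, Finset.sum_congr rfl fun Y _ => hrhs Y]


/-- ★★★ **THE FIRST-STEP MATRIX AT A PAIR `(𝕋, Λ₁)` FROM (i)+(ii) AND THE EXPLICIT IDENTITY** (dag-n08-w2's `FirstStepClausesAt θ p s′ u₁ e₁`).
[cite: Balaban1988Convergent, Thm 2 p.263, §3 p.279, (3.23)–(3.25) p.270, (2.27)–(2.31) pp.259–260; Balaban1987RG1, Thm 1 p.259] -/
theorem firstStepClausesAt_of_Omega_univ_of_identity (hM : 1 ≤ θ.τ9.M) (s' : SeqOfRecord F θ.ν θ.τ9.M (gOfRecord₁₃ F N θ.toStage13Params p) p.K 1)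
    (hΩ : s'.Ω 1 = Set.univ) (u₁ : Sect2.TermValues (F.P p.K) (MatA N) (FluctV N) θ.τ9.M) (e₁ : ℝ) {hdec : DecidableEq (PBond (F.P p.K) 0)}
    (hnew : Step.LFNewTerms (sect2TowerOfRecord F N (FluctV N) p.K (settingOfRecord₁₃ F N θ.toStage13Params p) (θ.rzAt p s') s' u₁)
      (settingOfRecord₁₃ F N θ.toStage13Params p).lf (settingOfRecord₁₃ F N θ.toStage13Params p).βc 0)
    (hanE : ∀ (X : (Sect2.domSys (F.P p.K) θ.τ9.M 1).Dom) (z : Site (F.P p.K) 1) (g : ℝ), 0 ≤ g → g ≤ (settingOfRecord₁₃ F N θ.toStage13Params p).lf.γ →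
      AnalyticOnNhd ℂ (u₁.E 1 X z g)
        ((sect2TowerOfRecord F N (FluctV N) p.K (settingOfRecord₁₃ F N θ.toStage13Params p) (θ.rzAt p s') s' u₁).space 1 X
          ((settingOfRecord₁₃ F N θ.toStage13Params p).lf.alpha0 ((settingOfRecord₁₃ F N θ.toStage13Params p).flow.g 1))
          ((settingOfRecord₁₃ F N θ.toStage13Params p).lf.alpha1 ((settingOfRecord₁₃ F N θ.toStage13Params p).flow.g 1))))
    (hanR : ∀ X : (Sect2.domSys (F.P p.K) θ.τ9.M 1).Dom,
      AnalyticOnNhd ℂ (u₁.R 1 X)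
        ((sect2TowerOfRecord F N (FluctV N) p.K (settingOfRecord₁₃ F N θ.toStage13Params p) (θ.rzAt p s') s' u₁).space 1 X
          ((settingOfRecord₁₃ F N θ.toStage13Params p).lf.alpha0 ((settingOfRecord₁₃ F N θ.toStage13Params p).flow.g 1))
          ((settingOfRecord₁₃ F N θ.toStage13Params p).lf.alpha1 ((settingOfRecord₁₃ F N θ.toStage13Params p).flow.g 1))))
    (hanB : ∀ (X : (Sect2.domSys (F.P p.K) θ.τ9.M 1).Dom) (a : SFluct (F.P p.K) (FluctV N)),
      AnalyticOnNhd ℂ (fun φ => u₁.B 1 X φ a)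
        ((sect2TowerOfRecord F N (FluctV N) p.K (settingOfRecord₁₃ F N θ.toStage13Params p) (θ.rzAt p s') s' u₁).spaceB 1 X))
    (hT : slotsTOfRecord F N θ.ν θ.τ9 (EOfRecord₁₃ F N θ.toStage13Params) (wOfRecord₉ F N θ.toStage9Params) θ.ppSel p (gOfRecord₁₃ F N θ.toStage13Params p) 1 s' = 0 ∨
      ∀ᵐ V' ∂fieldMeasure (F.P p.K) 1 (SU N),
        chiSeqOfRecord F N θ.ν θ.τ9.M (gOfRecord₁₃ F N θ.toStage13Params p) p.K 1 s' V' ≠ 0 →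
          transportOfRecord F N p.K 0 (fun U =>
              chiPrime (sect3DataOfRecord F N θ.ν θ.τ9.M p (gOfRecord₁₃ F N θ.toStage13Params p) 0 s'.init) (avOfRecord F N p.K)
                  (2 * deltaOfRecord θ.ν (gOfRecord₁₃ F N θ.toStage13Params p) 0 θ.A₁) (Finset.univ : Finset (Iχ F θ.ν p (gOfRecord₁₃ F N θ.toStage13Params p) 0)) U V' *
                (∑ R : Finset (Iχ F θ.ν p (gOfRecord₁₃ F N θ.toStage13Params p) 0), ∑ S : Finset (Iχ F θ.ν p (gOfRecord₁₃ F N θ.toStage13Params p) 0),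
                  if LambdaOfLabel F θ.ν θ.τ9.M p (gOfRecord₁₃ F N θ.toStage13Params p) 0 s'.init (∅, ∅, (R, ∅)) = s'.Λ 1 then
                    θ.ζ p (gOfRecord₁₃ F N θ.toStage13Params p) 0 s'.init ∅ ∅ (R, S) U V' else 0) *
                rhoZeroOfRecord F N p.K (gOfRecord₁₃ F N θ.toStage13Params p 0) (EOfRecord₁₃ F N θ.toStage13Params p) U) V' =
            ∑ Y ∈ (Set.toFinite {Y : Set (Site (F.P p.K) 0) | Y ∈ SClassOfRecord F θ.ν (gOfRecord₁₃ F N θ.toStage13Params p) p.K 1 ∧ Y ⊆ s'.Ω 1 ∩ (s'.Λ 1)ᶜ}).toFinset,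
              (WtOfRecord₁₃H F N θ p s').ζ 0 ∅ (baseCfg 1 V') *
                aOp 0 (genDataOfRecord F N (FluctV N) θ.ν θ.τ9.M (gOfRecord₁₃ F N θ.toStage13Params p) p.K (WtOfRecord₁₃H F N θ p s') s' (Function.update (fun _ => ∅) 1 Y) 0).sA
                  (genDataOfRecord F N (FluctV N) θ.ν θ.τ9.M (gOfRecord₁₃ F N θ.toStage13Params p) p.K (WtOfRecord₁₃H F N θ p s') s' (Function.update (fun _ => ∅) 1 Y) 0).w
                  (fun ω => sect2Operand F N (FluctV N) p.K (settingOfRecord₁₃ F N θ.toStage13Params p) (θ.rzAt p s') s' u₁ e₁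
                      (UbgOfRecord₁₃CoP F N θ.toStage13Params p 1 s') (Function.update (fun _ => ∅) 1 Y, fun j => (ω j).2) (fun j => (ω j).1))
                  (baseCfg 1 V')) :
    FirstStepClausesAt θ p s' u₁ e₁ :=
  ⟨hnew, hanE, hanR, hanB, (firstStep_O3_iff_of_Omega_univ θ p hM s' hΩ u₁ e₁ (hdec := hdec)).2 hT⟩

/-- ★★★ **THEOREM 1 AT LEVEL 1 ON THE LIVE-SELECTOR LINE, SPLIT BY THE KIND OF CHILD** (core provisos, selector clause, admissibility, signs, `1 ≤ M`, `0 < K`): first-step term values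
`u` universal in 𝐄 and constants `E₁` with the four level-1 𝐄-clauses at every history; at every 𝐓-present pair with `Ω₁ ⊊ 𝕋` (old variables RETAINED — the frozen-`y` road)
dag-n08-w2's first-step clauses; at every 𝐓-present pair with `Ω₁ = 𝕋` (nothing retained) r11's new-term clauses (i)+(ii) and the EXPLICIT identity of `firstStep_O3_iff_of_Omega_univ`;
and dag-n11-d's level-0 no-expansion clause for the base witness — THEN `SLaw₁₃CoPH θ p 1` (dag-n08-w2's ★ `sLaw₁₃CoPH_one_of_firstStepClauses`).
[cite: Balaban1988Convergent, Thm 1 p.262, Thm 2 p.263, Theorem p.245, (3.1) p.264, (3.23)–(3.25) p.270, §3 p.279; Balaban1987RG1, Thm 1 p.259; Balaban1989LargeFieldI, (0.2)–(0.4) p.176] -/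
theorem sLaw₁₃CoPH_one_of_split (hP : θ.Provisos₁₃CoPH F N)
    (hsel : θ.ppSel = ppSelLiveOfRecord F N θ.ν θ.τ9 (EOfRecord₁₃ F N θ.toStage13Params) (wOfRecord₉ F N θ.toStage9Params))
    (hθ : θ.Admissible F N) (hκ : 0 ≤ θ.s2.lf.κ) (hE₀ : 0 ≤ θ.s2.lf.E₀) (hB₀ : 0 ≤ θ.s2.lf.B₀) (hM : 1 ≤ θ.τ9.M) (hK : 0 < p.K)
    (u : SeqOfRecord F θ.ν θ.τ9.M (gOfRecord₁₃ F N θ.toStage13Params p) p.K 1 → Sect2.TermValues (F.P p.K) (MatA N) (FluctV N) θ.τ9.M)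
    (E₁ : SeqOfRecord F θ.ν θ.τ9.M (gOfRecord₁₃ F N θ.toStage13Params p) p.K 1 → ℝ) (hu : Sect2.UniversalE u)
    (hOE : ∀ s : SeqOfRecord F θ.ν θ.τ9.M (gOfRecord₁₃ F N θ.toStage13Params p) p.K 1, NewEClausesAt θ p 0 (u s) s)
    -- the pairs with `Ω₁ ⊊ 𝕋`: old variables retained — dag-n08-w2's first-step clauses (the frozen-`y` road supplies (iii) there)
    (hpres : ∀ s : SeqOfRecord F θ.ν θ.τ9.M (gOfRecord₁₃ F N θ.toStage13Params p) p.K 1, s.Ω 1 ≠ ∅ → s.Ω 1 ≠ Set.univ →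
      slotsTOfRecord F N θ.ν θ.τ9 (EOfRecord₁₃ F N θ.toStage13Params) (wOfRecord₉ F N θ.toStage9Params) θ.ppSel p (gOfRecord₁₃ F N θ.toStage13Params p) 1 s ≠ 0 →
        FirstStepClausesAt θ p s (u s) (E₁ s))
    -- the pairs with `Ω₁ = 𝕋`: nothing retained — (i)+(ii) and ONE explicit identity each
    (htop : ∀ s' : SeqOfRecord F θ.ν θ.τ9.M (gOfRecord₁₃ F N θ.toStage13Params p) p.K 1, s'.Ω 1 = Set.univ →
      slotsTOfRecord F N θ.ν θ.τ9 (EOfRecord₁₃ F N θ.toStage13Params) (wOfRecord₉ F N θ.toStage9Params) θ.ppSel p (gOfRecord₁₃ F N θ.toStage13Params p) 1 s' ≠ 0 →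
      Step.LFNewTerms (sect2TowerOfRecord F N (FluctV N) p.K (settingOfRecord₁₃ F N θ.toStage13Params p) (θ.rzAt p s') s' (u s'))
        (settingOfRecord₁₃ F N θ.toStage13Params p).lf (settingOfRecord₁₃ F N θ.toStage13Params p).βc 0 ∧
      (∀ (X : (Sect2.domSys (F.P p.K) θ.τ9.M 1).Dom) (z : Site (F.P p.K) 1) (g : ℝ), 0 ≤ g → g ≤ (settingOfRecord₁₃ F N θ.toStage13Params p).lf.γ →
        AnalyticOnNhd ℂ ((u s').E 1 X z g)
          ((sect2TowerOfRecord F N (FluctV N) p.K (settingOfRecord₁₃ F N θ.toStage13Params p) (θ.rzAt p s') s' (u s')).space 1 X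
            ((settingOfRecord₁₃ F N θ.toStage13Params p).lf.alpha0 ((settingOfRecord₁₃ F N θ.toStage13Params p).flow.g 1))
            ((settingOfRecord₁₃ F N θ.toStage13Params p).lf.alpha1 ((settingOfRecord₁₃ F N θ.toStage13Params p).flow.g 1)))) ∧
      (∀ X : (Sect2.domSys (F.P p.K) θ.τ9.M 1).Dom,
        AnalyticOnNhd ℂ ((u s').R 1 X)
          ((sect2TowerOfRecord F N (FluctV N) p.K (settingOfRecord₁₃ F N θ.toStage13Params p) (θ.rzAt p s') s' (u s')).space 1 X
            ((settingOfRecord₁₃ F N θ.toStage13Params p).lf.alpha0 ((settingOfRecord₁₃ F N θ.toStage13Params p).flow.g 1))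
            ((settingOfRecord₁₃ F N θ.toStage13Params p).lf.alpha1 ((settingOfRecord₁₃ F N θ.toStage13Params p).flow.g 1)))) ∧
      (∀ (X : (Sect2.domSys (F.P p.K) θ.τ9.M 1).Dom) (a : SFluct (F.P p.K) (FluctV N)),
        AnalyticOnNhd ℂ (fun φ => (u s').B 1 X φ a)
          ((sect2TowerOfRecord F N (FluctV N) p.K (settingOfRecord₁₃ F N θ.toStage13Params p) (θ.rzAt p s') s' (u s')).spaceB 1 X)) ∧
      ∀ᵐ V' ∂fieldMeasure (F.P p.K) 1 (SU N),
        chiSeqOfRecord F N θ.ν θ.τ9.M (gOfRecord₁₃ F N θ.toStage13Params p) p.K 1 s' V' ≠ 0 →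
          transportOfRecord F N p.K 0 (fun U =>
              chiPrime (sect3DataOfRecord F N θ.ν θ.τ9.M p (gOfRecord₁₃ F N θ.toStage13Params p) 0 s'.init) (avOfRecord F N p.K)
                  (2 * deltaOfRecord θ.ν (gOfRecord₁₃ F N θ.toStage13Params p) 0 θ.A₁) (Finset.univ : Finset (Iχ F θ.ν p (gOfRecord₁₃ F N θ.toStage13Params p) 0)) U V' *
                (∑ R : Finset (Iχ F θ.ν p (gOfRecord₁₃ F N θ.toStage13Params p) 0), ∑ S : Finset (Iχ F θ.ν p (gOfRecord₁₃ F N θ.toStage13Params p) 0),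
                  if LambdaOfLabel F θ.ν θ.τ9.M p (gOfRecord₁₃ F N θ.toStage13Params p) 0 s'.init (∅, ∅, (R, ∅)) = s'.Λ 1 then
                    θ.ζ p (gOfRecord₁₃ F N θ.toStage13Params p) 0 s'.init ∅ ∅ (R, S) U V' else 0) *
                rhoZeroOfRecord F N p.K (gOfRecord₁₃ F N θ.toStage13Params p 0) (EOfRecord₁₃ F N θ.toStage13Params p) U) V' =
            ∑ Y ∈ (Set.toFinite {Y : Set (Site (F.P p.K) 0) | Y ∈ SClassOfRecord F θ.ν (gOfRecord₁₃ F N θ.toStage13Params p) p.K 1 ∧ Y ⊆ s'.Ω 1 ∩ (s'.Λ 1)ᶜ}).toFinset,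
              (WtOfRecord₁₃H F N θ p s').ζ 0 ∅ (baseCfg 1 V') *
                aOp 0 (genDataOfRecord F N (FluctV N) θ.ν θ.τ9.M (gOfRecord₁₃ F N θ.toStage13Params p) p.K (WtOfRecord₁₃H F N θ p s') s' (Function.update (fun _ => ∅) 1 Y) 0).sA
                  (genDataOfRecord F N (FluctV N) θ.ν θ.τ9.M (gOfRecord₁₃ F N θ.toStage13Params p) p.K (WtOfRecord₁₃H F N θ p s') s' (Function.update (fun _ => ∅) 1 Y) 0).w
                  (fun ω => sect2Operand F N (FluctV N) p.K (settingOfRecord₁₃ F N θ.toStage13Params p) (θ.rzAt p s') s' (u s') (E₁ s')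
                      (UbgOfRecord₁₃CoP F N θ.toStage13Params p 1 s') (Function.update (fun _ => ∅) 1 Y, fun j => (ω j).2) (fun j => (ω j).1))
                  (baseCfg 1 V'))
    (hTcl : NoExpansionClauseFor θ p 0 (baseWitness θ p).1 (baseWitness θ p).2) : SLaw₁₃CoPH F N θ p 1 := by
  refine sLaw₁₃CoPH_one_of_firstStepClauses θ p hP hsel hθ hκ hE₀ hB₀ hM hK u E₁ hu hOE (fun s hne hT => ?_) hTcl
  by_cases htopc : s.Ω 1 = Set.univ
  · obtain ⟨hnew, hanE, hanR, hanB, hid⟩ := htop s htopc hT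
    exact firstStepClausesAt_of_Omega_univ_of_identity θ p hM s htopc (u s) (E₁ s) hnew hanE hanR hanB (Or.inr hid)
  · exact hpres s hne htopc hT

end FirstStep

end Summit.QuantumFields.YangMills.Theorems.BalabanUVNodesN11OmegaTopO3AtRecord13

end
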